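import Mathlib.Analysis.Normed.Group.Ultra
import Literature.NumberTheory.Automorphic.AdelicGLnGlue
import HarnessLib

/-!
# The adelic height on `GL_n(𝔸_K)`: finiteness of the local factors, positivity,
submultiplicativity (discharge of the named facts of `AdelicGLnGlue`)

Topic `NumberTheory/Automorphic`; sibling proof file of `AdelicGLnGlue`, which defines the
Borel–Jacquet height `‖g‖ = H_∞(g) · ∏ᶠ_v H_v(g)` on `GL_n(𝔸_K)` (`adelicHeightGL`,
`GLn.archHeight`, `GLn.localHeight`, with `H_v(g) = max_{i,j} (|g_{ij}|_v ⊔ |(g⁻¹)_{ij}|_v)`) and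
records its three basic properties as named facts. All three are proved here:

* `GLn.mulSupport_localHeight_finite_holds` — `H_v(g) = 1` for almost all `v` (`n ≥ 1`): the
  entries of `g` and `g⁻¹` are `v`-adic integers for almost all `v` (restricted product), so
  `H_v(g) ≤ 1`, and `H_v(g) ≥ 1` always (`1 = |(g g⁻¹)_{ii}|_v ≤ H_v(g)²`, ultrametric inequality);
* `adelicHeightGL_pos_holds` — `‖g‖ > 0` (`n ≥ 1`);
* `adelicHeightGL_mul_le_holds` — `‖g h‖ ≤ n ‖g‖ ‖h‖`: `H_v(gh) ≤ H_v(g) H_v(h)` at finite places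
  (ultrametric), `H_∞(gh) ≤ n H_∞(g) H_∞(h)` at infinity (an entry of a product is a sum of `n`
  products), and monotonicity of finite products.

Borel–Jacquet 1979, §1.2 (properties (i), (ii) of `‖·‖`) and §4.2; Moeglin–Waldspurger I.2.2.
Consequence used for moderate growth of translates (`AutomorphicForms.HasModerateGrowth`):
`one_sup_adelicHeightGL_mul_le` — `1 ⊔ ‖g h‖ ≤ (1 ⊔ n ‖h‖) (1 ⊔ ‖g‖)`.

## References

* A. Borel, H. Jacquet, *Automorphic forms and automorphic representations*, Proc. Sympos. Pure
  Math. 33 (1979), part 1, §1.2 and §4.2 [BorelJacquet1979].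
-/

noncomputable section

open scoped MatrixGroups NNReal Classical
open NumberField NumberField.mixedEmbedding IsDedekindDomain Filter

namespace Literature.NumberTheory.Automorphic

/-! ### Entries of products of matrices with bounded entries -/

section MatrixBounds

variable {m : Type*} [Fintype m] [DecidableEq m] {R : Type*}

omit [DecidableEq m] in
/-- Ultrametric case: if all entries of `A` have norm `≤ a` and all entries of `B` have norm `≤ b`,
then all entries of `A * B` have norm `≤ a b` (an entry of `A B` is a sum of products
`A_{ik} B_{kj}`, and the norm of a sum is at most the largest norm of a summand). [folklore] -/
theorem nnnorm_mul_apply_le_of_isUltrametricDist [SeminormedRing R] [IsUltrametricDist R]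
    {A B : Matrix m m R} {a b : ℝ≥0} (hA : ∀ i k, ‖A i k‖₊ ≤ a) (hB : ∀ k j, ‖B k j‖₊ ≤ b)
    (i j : m) : ‖(A * B) i j‖₊ ≤ a * b := by
  rw [Matrix.mul_apply]
  refine IsUltrametricDist.nnnorm_sum_le_of_forall_le fun k _ => ?_
  exact (nnnorm_mul_le _ _).trans (mul_le_mul' (hA i k) (hB k j))

omit [DecidableEq m] in
/-- General case: if all entries of `A` have norm `≤ a` and all entries of `B` have norm `≤ b`,
then all entries of `A * B` have norm `≤ (card m) a b`. [folklore] -/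
theorem nnnorm_mul_apply_le [SeminormedRing R] {A B : Matrix m m R} {a b : ℝ≥0}
    (hA : ∀ i k, ‖A i k‖₊ ≤ a) (hB : ∀ k j, ‖B k j‖₊ ≤ b) (i j : m) :
    ‖(A * B) i j‖₊ ≤ Fintype.card m * (a * b) := by
  rw [Matrix.mul_apply]
  refine (nnnorm_sum_le _ _).trans ?_
  calc ∑ k, ‖A i k * B k j‖₊ ≤ ∑ _k : m, a * b :=
        Finset.sum_le_sum fun k _ => (nnnorm_mul_le _ _).trans (mul_le_mul' (hA i k) (hB k j))
    _ = Fintype.card m * (a * b) := by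
        rw [Finset.sum_const, Finset.card_univ, nsmul_eq_mul]

/-- The "height" `max_{i,j} (‖g_{ij}‖ ⊔ ‖(g⁻¹)_{ij}‖)` of an invertible matrix bounds the entries
of `g`. [folklore] -/
theorem nnnorm_apply_le_sup [SeminormedRing R] (g : GL m R) (i j : m) :
    ‖(g : Matrix m m R) i j‖₊ ≤ Finset.univ.sup fun ij : m × m =>
      ‖(g : Matrix m m R) ij.1 ij.2‖₊ ⊔ ‖((g⁻¹ : GL m R) : Matrix m m R) ij.1 ij.2‖₊ :=
  le_sup_left.trans (Finset.le_sup (f := fun ij : m × m =>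
    ‖(g : Matrix m m R) ij.1 ij.2‖₊ ⊔ ‖((g⁻¹ : GL m R) : Matrix m m R) ij.1 ij.2‖₊)
      (Finset.mem_univ (i, j)))

/-- The "height" of an invertible matrix bounds the entries of `g⁻¹`. [folklore] -/
theorem nnnorm_inv_apply_le_sup [SeminormedRing R] (g : GL m R) (i j : m) :
    ‖((g⁻¹ : GL m R) : Matrix m m R) i j‖₊ ≤ Finset.univ.sup fun ij : m × m =>
      ‖(g : Matrix m m R) ij.1 ij.2‖₊ ⊔ ‖((g⁻¹ : GL m R) : Matrix m m R) ij.1 ij.2‖₊ :=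
  le_sup_right.trans (Finset.le_sup (f := fun ij : m × m =>
    ‖(g : Matrix m m R) ij.1 ij.2‖₊ ⊔ ‖((g⁻¹ : GL m R) : Matrix m m R) ij.1 ij.2‖₊)
      (Finset.mem_univ (i, j)))

/-- Submultiplicativity of the matrix height, ultrametric case: `H(g h) ≤ H(g) H(h)`
(`(gh)⁻¹ = h⁻¹ g⁻¹`). [folklore] -/
theorem sup_nnnorm_mul_le_of_isUltrametricDist [SeminormedRing R] [IsUltrametricDist R]
    (g h : GL m R) :
    (Finset.univ.sup fun ij : m × m => ‖((g * h : GL m R) : Matrix m m R) ij.1 ij.2‖₊ ⊔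
        ‖(((g * h)⁻¹ : GL m R) : Matrix m m R) ij.1 ij.2‖₊) ≤
      (Finset.univ.sup fun ij : m × m =>
          ‖(g : Matrix m m R) ij.1 ij.2‖₊ ⊔ ‖((g⁻¹ : GL m R) : Matrix m m R) ij.1 ij.2‖₊) *
        Finset.univ.sup fun ij : m × m =>
          ‖(h : Matrix m m R) ij.1 ij.2‖₊ ⊔ ‖((h⁻¹ : GL m R) : Matrix m m R) ij.1 ij.2‖₊ := by
  refine Finset.sup_le fun ij _ => sup_le ?_ ?_
  · rw [Units.val_mul]
    exact nnnorm_mul_apply_le_of_isUltrametricDist (nnnorm_apply_le_sup g) (nnnorm_apply_le_sup h)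
      ij.1 ij.2
  · rw [mul_inv_rev, Units.val_mul, mul_comm]
    exact nnnorm_mul_apply_le_of_isUltrametricDist (nnnorm_inv_apply_le_sup h)
      (nnnorm_inv_apply_le_sup g) ij.1 ij.2

/-- Submultiplicativity of the matrix height up to the constant `card m`, general case:
`H(g h) ≤ (card m) H(g) H(h)`. [folklore] -/
theorem sup_nnnorm_mul_le [SeminormedRing R] (g h : GL m R) :
    (Finset.univ.sup fun ij : m × m => ‖((g * h : GL m R) : Matrix m m R) ij.1 ij.2‖₊ ⊔
        ‖(((g * h)⁻¹ : GL m R) : Matrix m m R) ij.1 ij.2‖₊) ≤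
      Fintype.card m * ((Finset.univ.sup fun ij : m × m =>
          ‖(g : Matrix m m R) ij.1 ij.2‖₊ ⊔ ‖((g⁻¹ : GL m R) : Matrix m m R) ij.1 ij.2‖₊) *
        Finset.univ.sup fun ij : m × m =>
          ‖(h : Matrix m m R) ij.1 ij.2‖₊ ⊔ ‖((h⁻¹ : GL m R) : Matrix m m R) ij.1 ij.2‖₊) := by
  refine Finset.sup_le fun ij _ => sup_le ?_ ?_
  · rw [Units.val_mul]
    exact nnnorm_mul_apply_le (nnnorm_apply_le_sup g) (nnnorm_apply_le_sup h) ij.1 ij.2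
  · rw [mul_inv_rev, Units.val_mul, mul_comm (Finset.univ.sup _)]
    exact nnnorm_mul_apply_le (nnnorm_inv_apply_le_sup h) (nnnorm_inv_apply_le_sup g) ij.1 ij.2

/-- The matrix height is `≥ 1` over an ultrametric normed ring with `‖1‖ = 1` and `m` non-empty:
`1 = ‖(g g⁻¹)_{ii}‖ ≤ H(g)²`. [folklore] -/
theorem one_le_sup_nnnorm_of_isUltrametricDist [NormedRing R] [IsUltrametricDist R] [NormOneClass R]
    [Nonempty m] (g : GL m R) :
    1 ≤ Finset.univ.sup fun ij : m × m =>
      ‖(g : Matrix m m R) ij.1 ij.2‖₊ ⊔ ‖((g⁻¹ : GL m R) : Matrix m m R) ij.1 ij.2‖₊ := by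
  classical
  set H := Finset.univ.sup fun ij : m × m =>
      ‖(g : Matrix m m R) ij.1 ij.2‖₊ ⊔ ‖((g⁻¹ : GL m R) : Matrix m m R) ij.1 ij.2‖₊ with hH
  obtain ⟨i⟩ := ‹Nonempty m›
  have h1 : (1 : ℝ≥0) ≤ H * H := by
    have hone : ((g : Matrix m m R) * ((g⁻¹ : GL m R) : Matrix m m R)) i i = 1 := by
      rw [← Units.val_mul, mul_inv_cancel, Units.val_one, Matrix.one_apply_eq]
    have := nnnorm_mul_apply_le_of_isUltrametricDist (nnnorm_apply_le_sup g)
      (nnnorm_inv_apply_le_sup g) i i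
    rwa [hone, nnnorm_one] at this
  by_contra hlt
  rw [not_le] at hlt
  have : H * H < 1 := by
    calc H * H ≤ H * 1 := mul_le_mul' le_rfl hlt.le
      _ = H := mul_one H
      _ < 1 := hlt
  exact absurd h1 (not_le.2 this)

end MatrixBounds

/-! ### Local heights at finite places -/

section Local

variable {n : ℕ} {K : Type} [Field K] [NumberField K]

/-- **Submultiplicativity of the local heights**: `H_v(g h) ≤ H_v(g) H_v(h)` at a finite place
`v` (`K_v` is ultrametric). Borel–Jacquet 1979, §1.2. [cite: BorelJacquet1979, §1.2] -/
theorem GLn.localHeight_mul_le (v : HeightOneSpectrum (𝓞 K)) (g h : GL (Fin n) (AdeleRing (𝓞 K) K)) :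
    GLn.localHeight n K v (g * h) ≤ GLn.localHeight n K v g * GLn.localHeight n K v h := by
  unfold GLn.localHeight
  rw [map_mul]
  exact sup_nnnorm_mul_le_of_isUltrametricDist _ _

/-- **Local heights are at least `1`** (`n ≥ 1`): `1 = |(g_v g_v⁻¹)_{ii}|_v ≤ H_v(g)²`.
Borel–Jacquet 1979, §1.2 (property (i)). [cite: BorelJacquet1979, §1.2] -/
theorem GLn.one_le_localHeight [NeZero n] (v : HeightOneSpectrum (𝓞 K))
    (g : GL (Fin n) (AdeleRing (𝓞 K) K)) : 1 ≤ GLn.localHeight n K v g := by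
  haveI : Nonempty (Fin n) := ⟨⟨0, Nat.pos_of_ne_zero (NeZero.ne n)⟩⟩
  unfold GLn.localHeight
  exact one_le_sup_nnnorm_of_isUltrametricDist _

/-- At a place `v` where all entries of `g_v` and of `g_v⁻¹` are `v`-adic integers, `H_v(g) ≤ 1`.
Borel–Jacquet 1979, §1.2. [cite: BorelJacquet1979, §1.2] -/
theorem GLn.localHeight_le_one_of_forall_mem (v : HeightOneSpectrum (𝓞 K))
    (g : GL (Fin n) (AdeleRing (𝓞 K) K))
    (hg : ∀ i j, ((g : Matrix (Fin n) (Fin n) (AdeleRing (𝓞 K) K)) i j).2 v ∈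
      v.adicCompletionIntegers K)
    (hg' : ∀ i j, (((g⁻¹ : GL (Fin n) (AdeleRing (𝓞 K) K)) :
      Matrix (Fin n) (Fin n) (AdeleRing (𝓞 K) K)) i j).2 v ∈ v.adicCompletionIntegers K) :
    GLn.localHeight n K v g ≤ 1 := by
  unfold GLn.localHeight
  refine Finset.sup_le fun ij _ => sup_le ?_ ?_
  · have h := hg ij.1 ij.2
    rw [Matrix.GeneralLinearGroup.map_apply, AdelicGroupData.adeleEval_apply, ← NNReal.coe_le_coe,
      coe_nnnorm, NNReal.coe_one]
    exact Valued.toNormedField.norm_le_one_iff.2 h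
  · have h := hg' ij.1 ij.2
    rw [← map_inv, Matrix.GeneralLinearGroup.map_apply, AdelicGroupData.adeleEval_apply,
      ← NNReal.coe_le_coe, coe_nnnorm, NNReal.coe_one]
    exact Valued.toNormedField.norm_le_one_iff.2 h

/-- **Almost all local heights are `1`** (`n ≥ 1`): the entries of `g` and `g⁻¹` are finite adeles,
hence `v`-adic integers for all but finitely many `v`. Borel–Jacquet 1979, §1.2. [cite: BorelJacquet1979, §1.2] -/
theorem GLn.eventually_localHeight_eq_one [NeZero n] (g : GL (Fin n) (AdeleRing (𝓞 K) K)) :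
    ∀ᶠ v in cofinite, GLn.localHeight n K v g = 1 := by
  have hg : ∀ᶠ v : HeightOneSpectrum (𝓞 K) in cofinite, ∀ ij : Fin n × Fin n,
      ((g : Matrix (Fin n) (Fin n) (AdeleRing (𝓞 K) K)) ij.1 ij.2).2 v ∈
        v.adicCompletionIntegers K :=
    eventually_all.2 fun ij => ((g : Matrix (Fin n) (Fin n) (AdeleRing (𝓞 K) K)) ij.1 ij.2).2.2
  have hg' : ∀ᶠ v : HeightOneSpectrum (𝓞 K) in cofinite, ∀ ij : Fin n × Fin n,
      (((g⁻¹ : GL (Fin n) (AdeleRing (𝓞 K) K)) : Matrix (Fin n) (Fin n) (AdeleRing (𝓞 K) K))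
        ij.1 ij.2).2 v ∈ v.adicCompletionIntegers K :=
    eventually_all.2 fun ij =>
      ((((g⁻¹ : GL (Fin n) (AdeleRing (𝓞 K) K)) : Matrix (Fin n) (Fin n) (AdeleRing (𝓞 K) K))
        ij.1 ij.2).2.2)
  filter_upwards [hg, hg'] with v hv hv'
  exact le_antisymm (GLn.localHeight_le_one_of_forall_mem v g (fun i j => hv (i, j))
    (fun i j => hv' (i, j))) (GLn.one_le_localHeight v g)

/-- **Discharge of `GLn.mulSupport_localHeight_finite`**: `H_v(g) = 1` for all but finitely many
finite places `v` (`n ≥ 1`). Borel–Jacquet 1979, §1.2; Moeglin–Waldspurger I.2.2. [cite: BorelJacquet1979, §1.2] -/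
theorem GLn.mulSupport_localHeight_finite_holds :
    GLn.mulSupport_localHeight_finite (n := n) (K := K) := by
  intro _ g
  exact (GLn.eventually_localHeight_eq_one g)

/-- The finite part `∏ᶠ_v H_v(g)` of the height is at least `1` (`n ≥ 1`). Borel–Jacquet 1979, §1.2. [cite: BorelJacquet1979, §1.2] -/
theorem GLn.one_le_finprod_localHeight [NeZero n] (g : GL (Fin n) (AdeleRing (𝓞 K) K)) :
    1 ≤ ∏ᶠ v, (GLn.localHeight n K v g : ℝ) :=
  finprod_induction (fun x : ℝ => 1 ≤ x) le_rfl (fun _ _ ha hb => one_le_mul_of_one_le_of_one_le ha hb)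
    fun v => by exact_mod_cast GLn.one_le_localHeight v g

/-- The finite part of the height of a product: `∏ᶠ_v H_v(g h) ≤ (∏ᶠ_v H_v(g)) (∏ᶠ_v H_v(h))`
(`n ≥ 1`; pointwise submultiplicativity and monotonicity of finite products of reals `≥ 0`).
Borel–Jacquet 1979, §1.2. [cite: BorelJacquet1979, §1.2] -/
theorem GLn.finprod_localHeight_mul_le [NeZero n] (g h : GL (Fin n) (AdeleRing (𝓞 K) K)) :
    ∏ᶠ v, (GLn.localHeight n K v (g * h) : ℝ) ≤
      (∏ᶠ v, (GLn.localHeight n K v g : ℝ)) * ∏ᶠ v, (GLn.localHeight n K v h : ℝ) := by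
  have hfin : ∀ x : GL (Fin n) (AdeleRing (𝓞 K) K),
      Function.HasFiniteMulSupport fun v => (GLn.localHeight n K v x : ℝ) := by
    intro x
    refine (GLn.mulSupport_localHeight_finite_holds x).subset fun v hv => ?_
    simpa [Function.mem_mulSupport] using hv
  rw [← finprod_mul_distrib (hfin g) (hfin h)]
  refine finprod_le_finprod (hfin (g * h)) (fun _ => NNReal.coe_nonneg _) ?_ fun v => ?_
  · exact ((hfin g).union (hfin h)).subset (Function.mulSupport_mul _ _)
  · have := GLn.localHeight_mul_le v g h
    exact_mod_cast this

end Local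

/-! ### The archimedean height and the adelic height -/

section Global

variable {n : ℕ} {K : Type} [Field K] [NumberField K]

/-- **Submultiplicativity of the archimedean height** up to `n`: `H_∞(g h) ≤ n H_∞(g) H_∞(h)`
(an entry of `g_∞ h_∞` is a sum of `n` products of entries). Borel–Jacquet 1979, §1.2. [cite: BorelJacquet1979, §1.2] -/
theorem GLn.archHeight_mul_le (g h : GL (Fin n) (AdeleRing (𝓞 K) K)) :
    GLn.archHeight n K (g * h) ≤ n * (GLn.archHeight n K g * GLn.archHeight n K h) := by
  unfold GLn.archHeight
  rw [map_mul]
  have := sup_nnnorm_mul_le (GLn.toMixed n K g) (GLn.toMixed n K h)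
  rwa [Fintype.card_fin] at this

/-- The adelic height is non-negative. Borel–Jacquet 1979, §1.2. [cite: BorelJacquet1979, §1.2] -/
theorem adelicHeightGL_nonneg (g : GL (Fin n) (AdeleRing (𝓞 K) K)) : 0 ≤ adelicHeightGL n K g :=
  mul_nonneg (NNReal.coe_nonneg _) (finprod_nonneg fun _ => NNReal.coe_nonneg _)

/-- For `n = 0` the adelic height is the junk value `0` (all local heights are suprema over the
empty index set). [folklore] -/
theorem adelicHeightGL_eq_zero_of_eq_zero (hn : n = 0) (g : GL (Fin n) (AdeleRing (𝓞 K) K)) :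
    adelicHeightGL n K g = 0 := by
  subst hn
  have : GLn.archHeight 0 K g = 0 := by
    unfold GLn.archHeight
    rw [Finset.univ_eq_empty, Finset.sup_empty]
    rfl
  rw [adelicHeightGL, this, NNReal.coe_zero, zero_mul]

/-- **The archimedean height is positive** (`n ≥ 1`): `g_∞` is invertible, so the matrix height
`max (‖(g_∞)_{ij}‖ ⊔ ‖(g_∞⁻¹)_{ij}‖)` is non-zero — otherwise `g_∞ = 0` and `1 = g_∞ g_∞⁻¹ = 0` in
`M_n(K_∞)`, `K_∞ ≠ 0`. Borel–Jacquet 1979, §1.2 (property (i)). [cite: BorelJacquet1979, §1.2] -/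
theorem GLn.archHeight_pos [NeZero n] (g : GL (Fin n) (AdeleRing (𝓞 K) K)) :
    0 < GLn.archHeight n K g := by
  rw [pos_iff_ne_zero]
  intro h0
  unfold GLn.archHeight at h0
  have hall : ∀ i j, (GLn.toMixed n K g : Matrix (Fin n) (Fin n) (mixedSpace K)) i j = 0 := by
    intro i j
    have hle := nnnorm_apply_le_sup (GLn.toMixed n K g) i j
    rw [h0, nonpos_iff_eq_zero, nnnorm_eq_zero] at hle
    exact hle
  have hzero : (GLn.toMixed n K g : Matrix (Fin n) (Fin n) (mixedSpace K)) = 0 :=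
    Matrix.ext fun i j => hall i j
  have hone : (1 : Matrix (Fin n) (Fin n) (mixedSpace K)) = 0 := by
    rw [← Units.val_one, ← mul_inv_cancel (GLn.toMixed n K g), Units.val_mul, hzero, zero_mul]
  have h00 := congrFun (congrFun hone ⟨0, Nat.pos_of_ne_zero (NeZero.ne n)⟩)
    ⟨0, Nat.pos_of_ne_zero (NeZero.ne n)⟩
  rw [Matrix.one_apply_eq, Matrix.zero_apply] at h00
  exact one_ne_zero h00

/-- **Discharge of `adelicHeightGL_pos`**: `‖g‖ > 0` for `n ≥ 1` (`H_∞(g) > 0` and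
`∏ᶠ_v H_v(g) ≥ 1`). Borel–Jacquet 1979, §1.2 (property (i)). [cite: BorelJacquet1979, §1.2] -/
theorem adelicHeightGL_pos_holds : adelicHeightGL_pos (n := n) (K := K) := by
  intro _ g
  exact mul_pos (by exact_mod_cast GLn.archHeight_pos g)
    (lt_of_lt_of_le one_pos (GLn.one_le_finprod_localHeight g))

/-- **Submultiplicativity of the adelic height** with the constant `n`:
`‖g h‖ ≤ n ‖g‖ ‖h‖` for all `g, h ∈ GL_n(𝔸_K)` (`n ≥ 1`; for `n = 0` both sides vanish).
Borel–Jacquet 1979, §1.2 (property (ii)); Moeglin–Waldspurger I.2.2. [cite: BorelJacquet1979, §1.2] -/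
theorem adelicHeightGL_mul_le_const (g h : GL (Fin n) (AdeleRing (𝓞 K) K)) :
    adelicHeightGL n K (g * h) ≤ n * adelicHeightGL n K g * adelicHeightGL n K h := by
  rcases Nat.eq_zero_or_pos n with hn | hn
  · rw [adelicHeightGL_eq_zero_of_eq_zero hn, adelicHeightGL_eq_zero_of_eq_zero hn,
      adelicHeightGL_eq_zero_of_eq_zero hn]
    simp
  · haveI : NeZero n := ⟨hn.ne'⟩
    have harch : (GLn.archHeight n K (g * h) : ℝ) ≤
        n * ((GLn.archHeight n K g : ℝ) * GLn.archHeight n K h) := by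
      exact_mod_cast GLn.archHeight_mul_le g h
    have hfin := GLn.finprod_localHeight_mul_le g h
    unfold adelicHeightGL
    calc (GLn.archHeight n K (g * h) : ℝ) * ∏ᶠ v, (GLn.localHeight n K v (g * h) : ℝ)
        ≤ (n * ((GLn.archHeight n K g : ℝ) * GLn.archHeight n K h)) *
            ((∏ᶠ v, (GLn.localHeight n K v g : ℝ)) * ∏ᶠ v, (GLn.localHeight n K v h : ℝ)) :=
          mul_le_mul harch hfin (finprod_nonneg fun v => NNReal.coe_nonneg _) (by positivity)
      _ = n * ((GLn.archHeight n K g : ℝ) * ∏ᶠ v, (GLn.localHeight n K v g : ℝ)) *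
            ((GLn.archHeight n K h : ℝ) * ∏ᶠ v, (GLn.localHeight n K v h : ℝ)) := by ring

/-- **Discharge of `adelicHeightGL_mul_le`**: `∃ C, ∀ g h, ‖g h‖ ≤ C ‖g‖ ‖h‖` (with `C = n`).
Borel–Jacquet 1979, §1.2 (property (ii)). [cite: BorelJacquet1979, §1.2] -/
theorem adelicHeightGL_mul_le_holds : adelicHeightGL_mul_le n K :=
  ⟨n, adelicHeightGL_mul_le_const⟩

/-- **The moderate-growth form of submultiplicativity**: `1 ⊔ ‖g h‖ ≤ (1 ⊔ n ‖h‖) (1 ⊔ ‖g‖)`,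
the inequality `height_mul_le` of `AutomorphyDatum.IsRegular` for the `GL_n` datum (right
translates of functions of moderate growth have moderate growth). Borel–Jacquet 1979, §1.2 and
§4.2. [cite: BorelJacquet1979, §1.2 and §4.2] -/
theorem one_sup_adelicHeightGL_mul_le (g h : GL (Fin n) (AdeleRing (𝓞 K) K)) :
    1 ⊔ adelicHeightGL n K (g * h) ≤
      (1 ⊔ n * adelicHeightGL n K h) * (1 ⊔ adelicHeightGL n K g) := by
  have hg := adelicHeightGL_nonneg g
  have hh := adelicHeightGL_nonneg h
  have h1 : (1 : ℝ) ≤ (1 ⊔ n * adelicHeightGL n K h) * (1 ⊔ adelicHeightGL n K g) := by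
    calc (1 : ℝ) = 1 * 1 := (mul_one 1).symm
      _ ≤ (1 ⊔ n * adelicHeightGL n K h) * (1 ⊔ adelicHeightGL n K g) :=
          mul_le_mul le_sup_left le_sup_left zero_le_one (zero_le_one.trans le_sup_left)
  have h2 : adelicHeightGL n K (g * h) ≤ (1 ⊔ n * adelicHeightGL n K h) * (1 ⊔ adelicHeightGL n K g) :=
    calc adelicHeightGL n K (g * h) ≤ n * adelicHeightGL n K g * adelicHeightGL n K h :=
          adelicHeightGL_mul_le_const g h
      _ = (n * adelicHeightGL n K h) * adelicHeightGL n K g := by ring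
      _ ≤ (1 ⊔ n * adelicHeightGL n K h) * (1 ⊔ adelicHeightGL n K g) :=
          mul_le_mul le_sup_right le_sup_right hg (zero_le_one.trans le_sup_left)
  exact sup_le h1 h2

end Global

end Literature.NumberTheory.Automorphic
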